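import Summits.QuantumFields.BalabanUV.T4Continuum.Spine.NE2.PrincipalB9Rate

/-!
# T⁴ programme, spine node NE2 (U1a) — THE `Δ′` PLAQUETTE-FIELD HYPOTHESES SUPPLIED FROM THE LATTICE FIELD STRENGTH OF THE DATA
# (cell `pub-balaban-gaps`, seat ne2 gen 3; lead ruling [LEAD-G6-RULINGS-1] (R-1): «suppliers of the seven `Δ′` data hypotheses»)

The rate ENDs `DeltaPrimeData.principalB9_deltaPrime_rate_of_small` / `PrincipalB9Rate.balaban326_rate_of_small` display SEVEN data bounds about (3.10)'s
`Δ′`: `‖V_k − 1‖ ≤ α₁/L^k` and, for EACH of the plaquette colour fields `S_k = symF(c_k²(Re U_k(∂p) − 1))`, `B_k = brkF(c_k² Im U_k(∂p))`, a size, a block-parent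
consistency and a lattice-Lipschitz bound.  THIS FILE supplies the six plaquette-field bounds from THREE bounds on ONE object, the lattice field strength of
the data in physical units `F_k(p) := c_k²·(U_k(∂p) − 1)`, `c_k = L^k = η_k⁻¹` (**`Fstr`**): (F0) size `‖F_k‖ ≤ α₀` — the (3.35) shape «`|∇^η_U A| <
O(1)Mα₀(Lʲη)⁻²`» read on plaquettes; (F1) lattice-Lipschitz `‖F_k(x − e_λ) − F_k(x)‖ ≤ α₀′/L^k` — the (3.36) shape «`|∇^η_U∇^η_U A| < O(1)Mα₀(Lʲη)⁻³`»;
(Fc) block-parent consistency `‖F_{k+1}(y) − F_k(par y)‖ ≤ ρ/L^k` — node NE3's currency.  MECHANISM (§2, exact identities for unitary `U(∂p)`):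
`c²·Im U(∂p) = (−i/2)(F − Fᴴ)` (**`csq_smul_imHol_eq`**) and `2c²·[c²(Re U(∂p) − 1)] = −F·Fᴴ` (**`two_csq_smul_reW_eq`**) — the argument of `S` is SECOND
ORDER in the field strength («Δ′ will be a bounded, small operator», p. 392), so its size, consistency AND Lipschitz bounds all follow from (F0) alone
(`‖c_k²(Re U_k(∂p) − 1)‖ ≤ α₀²/(2c_k²)`), while those of `B` are (F0), (Fc), (F1) read through the bounded linear map `brkF` (§1: `symF`, `brkF` as continuous
linear maps **`symL`**, **`brkL`**; the constants are their operator norms, depending on the component family only).  §3: the six suppliers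
**`norm_Sfield_le'`**, **`Sfield_consistent`**, **`Sfield_lipschitz`**, **`norm_Bfield_le`**, **`Bfield_consistent`**, **`Bfield_lipschitz`**.  §4: the END
**`balaban326_rate_of_fieldStrength`** = `balaban326_rate_of_small` with the six plaquette-field binders DISCHARGED: the `Δ′` hypotheses are now
`‖V_k − 1‖ ≤ α₁/L^k`, (F0), (F1), (Fc) — four bounds on the bond variables and plaquette holonomies of the DATA `V` — and the threshold reads
`κ_H + kappaDP d a (‖symL‖α₀²/2) (‖brkL‖α₀) < 1`.
HONEST FRAMING (T4-DAG p. 1).  Composition BY NAME at MODEL LEVEL (`V`, `e`, `c` DATA; hypothesis shapes displayed; nothing printed is a hypothesis or a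
conclusion); NOT asserted: that `V` is Bałaban's minimiser or that (F0)/(F1)/(Fc) hold for it (node NE3, OPEN; (3.35)–(3.36) are Bałaban's theorems about the
minimiser in his regular gauge, not formalised), the [B7] averaging (residual r2), m = k layer uniformity beyond the tree's `TowerLimitRate` currency; NE2 (U1a)
NOT PROVED; spine PROVED 0/9 unchanged; NOT continuum YM / infinite volume / mass gap / Clay.  HONEST DEPENDENCY: continuum YM on T⁴ ⇐ BetaPertH ∧ nine
spine estimates (0/9 proved); BetaPertH ⇐ (D1) ∧ (D4) ∧ CAP+tail; G-an2-4 gates asym, D1 and NE2/3/4.  No `sorry`.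
-/

noncomputable section

open scoped BigOperators ComplexConjugate Matrix

namespace Summit.QuantumFields.BalabanUV.T4Continuum.NE2.DeltaPrimeFieldStrength

open scoped Kronecker Matrix.Norms.L2Operator
open Literature.MathematicalPhysics.QuantumFieldTheory.Balaban1983to89.B5Prop11Plancherel (Tor fine unitVec Cst)
open Literature.MathematicalPhysics.QuantumFieldTheory.Balaban1983to89.B5G183RateUnitTower (lev lev_neZero)
open Literature.MathematicalPhysics.QuantumFieldTheory.Balaban1983to89.T4EtaRateMin (LocalRate)
open Summit.QuantumFields.BalabanUV.T4Continuum
open Summit.QuantumFields.BalabanUV.T4Continuum.BalabanAveragedTowerUnit (Qlev one_le_lev' lev_succ')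
open Summit.QuantumFields.BalabanUV.T4Continuum.BalabanAveragedTowerModes (par)
open Summit.QuantumFields.BalabanUV.T4Continuum.CovariantAveragingTower (TowerLimitRate)
open Summit.QuantumFields.BalabanUV.T4Continuum.CovariantBlockAveraging (QcovLev)
open Summit.QuantumFields.BalabanUV.T4Continuum.BackgroundResolventTower (Cpert)
open Summit.QuantumFields.BalabanUV.T4Continuum.KingPairingPlantedLaw (CJ)
open Summit.QuantumFields.BalabanUV.T4Continuum.NE2FromNE3 (bgReadings)
open Summit.QuantumFields.BalabanUV.T4Continuum.RegularBackgroundTower (betaNE3 lev_pos)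
open Summit.QuantumFields.BalabanUV.T4Continuum.HolonomyTowerRegular (RegularSites regClass₂)
open Summit.QuantumFields.BalabanUV.T4Continuum.GaugeTermScalarData (QuT)
open Summit.QuantumFields.BalabanUV.T4Continuum.RegularSiteTransporters (siteT)
open Summit.QuantumFields.BalabanUV.T4Continuum.NestedContourTransport (theta0)
open Summit.QuantumFields.BalabanUV.T4Continuum.GramPerturbationLaw (C2gram)
open Summit.QuantumFields.BalabanUV.T4Continuum.NE2BalabanGauge (liftR)
open Summit.QuantumFields.BalabanUV.T4Continuum.NE2BalabanLayerSharp (kappaBs C2Bs)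
open Summit.QuantumFields.BalabanUV.T4Continuum.NE2BalabanWiring (epsR CdeltaR)
open Summit.QuantumFields.BalabanUV.T4Continuum.NE2BalabanFinal (kappa4F C4F)
open Summit.QuantumFields.BalabanUV.T4Continuum.NE2BalabanThreshold (etaStar)
open Summit.QuantumFields.BalabanUV.T4Continuum.GaugeTermSandwichBound (projP)
open Summit.QuantumFields.BalabanUV.T4Continuum.GaugeTermLayer (Gop)
open Summit.QuantumFields.BalabanUV.Beta.AdjointCarrierWiringEnd (CompFamily)
open Summit.QuantumFields.BalabanUV.T4Continuum.NE2.AdjointFieldInstance (adRep)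
open Summit.QuantumFields.BalabanUV.T4Continuum.NE2.DeltaPrimeOperator
open Summit.QuantumFields.BalabanUV.T4Continuum.NE2.DeltaPrimeCatalogue
open Summit.QuantumFields.BalabanUV.T4Continuum.NE2.DictionaryB0 (principalB9)
open Summit.QuantumFields.BalabanUV.T4Continuum.NE2.DeltaPrimeSecondOrder
open Summit.QuantumFields.BalabanUV.T4Continuum.NE2.PrincipalB9Rate (balaban326_rate_of_small)

variable {n : Type} [Fintype n] [DecidableEq n] {ι : Type} [Fintype ι] [DecidableEq ι]

/-! ## §1 `symF` and `brkF` are bounded linear maps of the colour matrix -/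

section Linear

variable (c : ℝ) (e : ι → Matrix n n ℂ)

omit [Fintype ι] [DecidableEq ι] in
/-- `symF` is additive in the colour matrix. [folklore] -/
theorem symF_add (W W' : Matrix n n ℂ) : symF c e (W + W') = symF c e W + symF c e W' := by
  ext k l
  simp only [symF, Matrix.of_apply, Matrix.add_apply, mul_add, Matrix.trace_add]

omit [DecidableEq n] [Fintype ι] [DecidableEq ι] in
/-- `symF` is homogeneous in the colour matrix. [folklore] -/
theorem symF_smul (s : ℂ) (W : Matrix n n ℂ) : symF c e (s • W) = s • symF c e W := by
  ext k l
  simp only [symF, Matrix.of_apply, Matrix.smul_apply, Matrix.mul_smul, Matrix.trace_smul, smul_eq_mul]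
  ring

omit [Fintype ι] [DecidableEq ι] in
/-- `brkF` is additive in the colour matrix. [folklore] -/
theorem brkF_add (X X' : Matrix n n ℂ) : brkF c e (X + X') = brkF c e X + brkF c e X' := by
  ext k l
  simp only [brkF, Matrix.of_apply, Matrix.add_apply, mul_add, Matrix.trace_add]

omit [DecidableEq n] [Fintype ι] [DecidableEq ι] in
/-- `brkF` is homogeneous in the colour matrix. [folklore] -/
theorem brkF_smul (s : ℂ) (X : Matrix n n ℂ) : brkF c e (s • X) = s • brkF c e X := by
  ext k l
  simp only [brkF, Matrix.of_apply, Matrix.smul_apply, Matrix.mul_smul, Matrix.trace_smul, smul_eq_mul]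
  ring

/-- **`symF` as a continuous linear map** `M_n(ℂ) → M_ι(ℂ)` (finite dimensions; `ℓ²`-operator norms on both sides).  Its operator norm `‖symL c e‖` is the
constant through which the second-order plaquette field is read — it depends on the component family only. [folklore] -/
def symL : Matrix n n ℂ →L[ℂ] Matrix ι ι ℂ :=
  LinearMap.toContinuousLinearMap { toFun := symF c e, map_add' := symF_add c e, map_smul' := symF_smul c e }

/-- **`brkF` as a continuous linear map** `M_n(ℂ) → M_ι(ℂ)`; `‖brkL c e‖` is the constant of the commutator block. [folklore] -/
def brkL : Matrix n n ℂ →L[ℂ] Matrix ι ι ℂ :=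
  LinearMap.toContinuousLinearMap { toFun := brkF c e, map_add' := brkF_add c e, map_smul' := brkF_smul c e }

omit [Fintype ι] [DecidableEq ι] in
/-- unfolding. [folklore] -/
@[simp] theorem symL_apply (W : Matrix n n ℂ) : symL c e W = symF c e W := rfl

omit [Fintype ι] [DecidableEq ι] in
/-- unfolding. [folklore] -/
@[simp] theorem brkL_apply (X : Matrix n n ℂ) : brkL c e X = brkF c e X := rfl

/-- `‖symF W‖ ≤ ‖symL‖·‖W‖`. [folklore] -/
theorem norm_symF_le (W : Matrix n n ℂ) : ‖symF c e W‖ ≤ ‖symL c e‖ * ‖W‖ := by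
  simpa only [symL_apply] using (symL c e).le_opNorm W

/-- `‖symF W − symF W′‖ ≤ ‖symL‖·‖W − W′‖`. [folklore] -/
theorem norm_symF_sub_le (W W' : Matrix n n ℂ) : ‖symF c e W - symF c e W'‖ ≤ ‖symL c e‖ * ‖W - W'‖ := by
  simpa only [map_sub, symL_apply] using (symL c e).le_opNorm (W - W')

/-- `‖brkF X‖ ≤ ‖brkL‖·‖X‖`. [folklore] -/
theorem norm_brkF_le (X : Matrix n n ℂ) : ‖brkF c e X‖ ≤ ‖brkL c e‖ * ‖X‖ := by
  simpa only [brkL_apply] using (brkL c e).le_opNorm X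

/-- `‖brkF X − brkF X′‖ ≤ ‖brkL‖·‖X − X′‖`. [folklore] -/
theorem norm_brkF_sub_le (X X' : Matrix n n ℂ) : ‖brkF c e X - brkF c e X'‖ ≤ ‖brkL c e‖ * ‖X - X'‖ := by
  simpa only [map_sub, brkL_apply] using (brkL c e).le_opNorm (X - X')

end Linear

/-! ## §2 The lattice field strength in physical units and the two exact identities -/

section FieldStrength

variable {d : ℕ} (Nf : Fin d → ℕ) [hNf : ∀ μ, NeZero (Nf μ)] (cη : ℝ)

/-- **THE LATTICE FIELD STRENGTH IN PHYSICAL UNITS** of a bond field at the plaquette `p_{μν}(x)`: `F(p) = c_η²·(U(∂p) − 1)`, `c_η = η⁻¹` (so `U(∂p) = 1 + η²F(p)`;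
for `U = e^{iηA}` smooth, `F = i·(curl A + i[A, A]) + O(η)` — the object the (3.35) bound `|∇^η_U A| < O(1)Mα₀(Lʲη)⁻²` controls on plaquettes).  DATA; nothing about a
minimiser. [cite: Balaban1985BackgroundPropagators, (3.4) p.391, (3.35) p.396 (shapes)] [folklore] -/
def Fstr (V : Fin d → Tor Nf → Matrix n n ℂ) (μ ν : Fin d) (x : Tor Nf) : Matrix n n ℂ :=
  ((cη : ℂ) ^ 2) • (plaqHol Nf V x μ ν - 1)

omit hNf in
/-- `Fᴴ = c_η²·(U(∂p)ᴴ − 1)` (real scalar). [folklore] -/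
theorem conjTranspose_Fstr (V : Fin d → Tor Nf → Matrix n n ℂ) (μ ν : Fin d) (x : Tor Nf) :
    (Fstr Nf cη V μ ν x)ᴴ = ((cη : ℂ) ^ 2) • ((plaqHol Nf V x μ ν)ᴴ - 1) := by
  rw [Fstr, Matrix.conjTranspose_smul, Complex.star_def, map_pow, Complex.conj_ofReal, Matrix.conjTranspose_sub, Matrix.conjTranspose_one]

variable {Nf cη}

omit hNf in
/-- **IDENTITY 1 (commutator block)**: for a unitary bond field, `c_η²·Im U(∂p) = (−i/2)·(F − Fᴴ)` — FIRST order in the field strength. [folklore] -/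
theorem csq_smul_imHol_eq {V : Fin d → Tor Nf → Matrix n n ℂ} (hV : ∀ μ x, V μ x ∈ Matrix.unitaryGroup n ℂ) (μ ν : Fin d) (x : Tor Nf) :
    ((cη : ℂ) ^ 2) • imHol Nf V x μ ν = (-Complex.I / 2) • (Fstr Nf cη V μ ν x - (Fstr Nf cη V μ ν x)ᴴ) := by
  have hP := plaqHol_mem_unitaryGroup Nf hV x μ ν
  rw [conjTranspose_Fstr, Fstr, ← smul_sub, sub_sub_sub_cancel_right, smul_comm, imHol,
    Matrix.inv_eq_left_inv (Matrix.mem_unitaryGroup_iff'.mp hP), Matrix.star_eq_conjTranspose]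

omit hNf in
/-- **IDENTITY 2 (second-order block)**: for a unitary bond field, `2c_η²·[c_η²(Re U(∂p) − 1)] = −F·Fᴴ` — the argument of `S` is SECOND order in the field
strength (`(U − 1)(U − 1)ᴴ = 2 − U − Uᴴ` for unitary `U`). [folklore] -/
theorem two_csq_smul_reW_eq {V : Fin d → Tor Nf → Matrix n n ℂ} (hV : ∀ μ x, V μ x ∈ Matrix.unitaryGroup n ℂ) (μ ν : Fin d) (x : Tor Nf) :
    (2 * (cη : ℂ) ^ 2) • (((cη : ℂ) ^ 2) • (reHol Nf V x μ ν - 1)) = -(Fstr Nf cη V μ ν x * (Fstr Nf cη V μ ν x)ᴴ) := by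
  have hP := plaqHol_mem_unitaryGroup Nf hV x μ ν
  have hPP : plaqHol Nf V x μ ν * (plaqHol Nf V x μ ν)ᴴ = 1 := by
    rw [← Matrix.star_eq_conjTranspose]; exact Matrix.mem_unitaryGroup_iff.mp hP
  set P := plaqHol Nf V x μ ν with hPdef
  have key : (P - 1) * (Pᴴ - 1) = (2 : ℂ) • (1 : Matrix n n ℂ) - P - Pᴴ := by
    rw [Matrix.sub_mul, Matrix.mul_sub, Matrix.mul_sub, hPP, Matrix.one_mul, Matrix.one_mul, Matrix.mul_one]
    module
  rw [conjTranspose_Fstr, Fstr, reHol, ← hPdef, Matrix.inv_eq_left_inv (Matrix.mem_unitaryGroup_iff'.mp hP), Matrix.star_eq_conjTranspose,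
    Matrix.smul_mul, Matrix.mul_smul, smul_smul, smul_smul, key]
  module

omit hNf in
/-- `‖(−i/2)·(X − Xᴴ)‖ ≤ ‖X‖`. [folklore] -/
theorem norm_skewHalf_le (X : Matrix n n ℂ) : ‖(-Complex.I / 2) • (X - Xᴴ)‖ ≤ ‖X‖ := by
  rw [norm_smul, show ‖(-Complex.I / 2 : ℂ)‖ = 1 / 2 by simp]
  have h := norm_sub_le X Xᴴ
  rw [Matrix.l2_opNorm_conjTranspose] at h
  linarith

omit hNf in
/-- **SIZE OF THE COMMUTATOR ARGUMENT**: `‖c_η²·Im U(∂p)‖ ≤ ‖F‖`. [folklore] -/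
theorem norm_csq_smul_imHol_le {V : Fin d → Tor Nf → Matrix n n ℂ} (hV : ∀ μ x, V μ x ∈ Matrix.unitaryGroup n ℂ) (μ ν : Fin d) (x : Tor Nf) :
    ‖((cη : ℂ) ^ 2) • imHol Nf V x μ ν‖ ≤ ‖Fstr Nf cη V μ ν x‖ := by
  rw [csq_smul_imHol_eq hV]; exact norm_skewHalf_le _

omit hNf in
/-- **DIFFERENCE OF COMMUTATOR ARGUMENTS** (two unitary bond fields, on possibly different lattices): `‖c′²·Im U′(∂p′) − c²·Im U(∂p)‖ ≤ ‖F′ − F‖`. [folklore] -/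
theorem norm_csq_smul_imHol_sub_le {Nf' : Fin d → ℕ} [∀ μ, NeZero (Nf' μ)] {cη' : ℝ} {V : Fin d → Tor Nf → Matrix n n ℂ} {V' : Fin d → Tor Nf' → Matrix n n ℂ}
    (hV : ∀ μ x, V μ x ∈ Matrix.unitaryGroup n ℂ) (hV' : ∀ μ x, V' μ x ∈ Matrix.unitaryGroup n ℂ) (μ ν : Fin d) (x : Tor Nf) (μ' ν' : Fin d) (x' : Tor Nf') :
    ‖((cη' : ℂ) ^ 2) • imHol Nf' V' x' μ' ν' - ((cη : ℂ) ^ 2) • imHol Nf V x μ ν‖ ≤ ‖Fstr Nf' cη' V' μ' ν' x' - Fstr Nf cη V μ ν x‖ := by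
  rw [csq_smul_imHol_eq hV, csq_smul_imHol_eq hV', ← smul_sub, show Fstr Nf' cη' V' μ' ν' x' - (Fstr Nf' cη' V' μ' ν' x')ᴴ
      - (Fstr Nf cη V μ ν x - (Fstr Nf cη V μ ν x)ᴴ) = (Fstr Nf' cη' V' μ' ν' x' - Fstr Nf cη V μ ν x) - (Fstr Nf' cη' V' μ' ν' x' - Fstr Nf cη V μ ν x)ᴴ by
    rw [Matrix.conjTranspose_sub]; abel]
  exact norm_skewHalf_le _

omit hNf in
/-- **SIZE OF THE SECOND-ORDER ARGUMENT**: for `c_η ≠ 0`, `‖c_η²(Re U(∂p) − 1)‖ ≤ ‖F‖²/(2c_η²)`. [folklore] -/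
theorem norm_reW_le {V : Fin d → Tor Nf → Matrix n n ℂ} (hV : ∀ μ x, V μ x ∈ Matrix.unitaryGroup n ℂ) (hc : 0 < cη) (μ ν : Fin d) (x : Tor Nf) :
    ‖((cη : ℂ) ^ 2) • (reHol Nf V x μ ν - 1)‖ ≤ ‖Fstr Nf cη V μ ν x‖ ^ 2 / (2 * cη ^ 2) := by
  have hn : ‖(2 * (cη : ℂ) ^ 2) • (((cη : ℂ) ^ 2) • (reHol Nf V x μ ν - 1))‖ = 2 * cη ^ 2 * ‖((cη : ℂ) ^ 2) • (reHol Nf V x μ ν - 1)‖ := by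
    rw [norm_smul, norm_mul, norm_pow, Complex.norm_real, Real.norm_eq_abs, abs_of_pos hc]; simp
  have hb : ‖(2 * (cη : ℂ) ^ 2) • (((cη : ℂ) ^ 2) • (reHol Nf V x μ ν - 1))‖ ≤ ‖Fstr Nf cη V μ ν x‖ ^ 2 := by
    rw [two_csq_smul_reW_eq hV, norm_neg, sq]
    exact (Matrix.l2_opNorm_mul _ _).trans (by rw [Matrix.l2_opNorm_conjTranspose])
  rw [le_div_iff₀ (by positivity : (0 : ℝ) < 2 * cη ^ 2), mul_comm, ← hn]
  exact hb

end FieldStrength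

/-! ## §3 The six plaquette-field bounds along a bond-field tower, from (F0), (F1), (Fc) -/

section Tower

variable {d : ℕ} (L : ℕ) [NeZero L] (M : Fin d → ℕ) [hM : ∀ μ, NeZero (M μ)] (c : ℝ) (e : ι → Matrix n n ℂ)
variable (V : (k : ℕ) → Fin d → Tor (fine (lev L k) M) → Matrix.unitaryGroup n ℂ)

omit hM in
/-- `t/c_k² ≤ t/c_k` for `t ≥ 0` (`c_k ≥ 1`). [folklore] -/
theorem div_levsq_le {t : ℝ} (ht : 0 ≤ t) (k : ℕ) : t / (((lev L k : ℕ) : ℝ) ^ 2) ≤ t / ((lev L k : ℕ) : ℝ) := by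
  have h1 : (1 : ℝ) ≤ (lev L k : ℕ) := by exact_mod_cast one_le_lev' L k
  exact div_le_div_of_nonneg_left ht (by positivity) (by nlinarith)

omit hM in
/-- `t/c_{k+1}² ≤ t/c_k` for `t ≥ 0`. [folklore] -/
theorem div_levsq_succ_le {t : ℝ} (ht : 0 ≤ t) (k : ℕ) : t / (((lev L (k + 1) : ℕ) : ℝ) ^ 2) ≤ t / ((lev L k : ℕ) : ℝ) := by
  have h1 : (1 : ℝ) ≤ (lev L k : ℕ) := by exact_mod_cast one_le_lev' L k
  have hL : (1 : ℝ) ≤ L := by exact_mod_cast Nat.pos_of_ne_zero (NeZero.ne L)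
  have hle : ((lev L k : ℕ) : ℝ) ≤ ((lev L (k + 1) : ℕ) : ℝ) := by rw [lev_succ']; push_cast; nlinarith
  exact div_le_div_of_nonneg_left ht (by positivity) (by nlinarith)

omit hM in
/-- **(S-size)**: `‖S_k‖ ≤ ‖symL‖·α₀²/(2c_k²)` from (F0) alone (second order). [folklore] -/
theorem norm_Sfield_le {α₀ : ℝ}
    (hF0 : ∀ k μ ν x, ‖Fstr (fine (lev L k) M) (lev L k) (fun ν x => (V k ν x : Matrix n n ℂ)) μ ν x‖ ≤ α₀) (k : ℕ) (μ ν : Fin d)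
    (x : Tor (fine (lev L k) M)) :
    ‖Sfield (fine (lev L k) M) (lev L k) c e (fun ν x => (V k ν x : Matrix n n ℂ)) μ ν x‖ ≤ ‖symL c e‖ * α₀ ^ 2 / (2 * ((lev L k : ℕ) : ℝ) ^ 2) := by
  have hα₀ : 0 ≤ α₀ := (norm_nonneg _).trans (hF0 k μ ν x)
  have hc : (0 : ℝ) < ((lev L k : ℕ) : ℝ) := lev_pos L k
  rw [Sfield]
  refine (norm_symF_le c e _).trans ?_
  rw [mul_div_assoc]
  refine mul_le_mul_of_nonneg_left ?_ (norm_nonneg (symL c e))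
  refine (norm_reW_le (fun μ x => (V k μ x).2) hc μ ν x).trans ?_
  exact div_le_div_of_nonneg_right (pow_le_pow_left₀ (norm_nonneg _) (hF0 k μ ν x) 2) (by positivity)

omit hM in
/-- **(S-size), uniform form**: `‖S_k‖ ≤ ‖symL‖·α₀²/2`. [folklore] -/
theorem norm_Sfield_le' {α₀ : ℝ}
    (hF0 : ∀ k μ ν x, ‖Fstr (fine (lev L k) M) (lev L k) (fun ν x => (V k ν x : Matrix n n ℂ)) μ ν x‖ ≤ α₀) (k : ℕ) (μ ν : Fin d)
    (x : Tor (fine (lev L k) M)) :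
    ‖Sfield (fine (lev L k) M) (lev L k) c e (fun ν x => (V k ν x : Matrix n n ℂ)) μ ν x‖ ≤ ‖symL c e‖ * α₀ ^ 2 / 2 := by
  refine (norm_Sfield_le L M c e V hF0 k μ ν x).trans ?_
  have h1 : (1 : ℝ) ≤ (lev L k : ℕ) := by exact_mod_cast one_le_lev' L k
  exact div_le_div_of_nonneg_left (by positivity) (by positivity) (by nlinarith)

omit hM in
/-- **(S-size) with the level factor**: `‖S_k‖ ≤ (‖symL‖·α₀²/2)/L^k` (`c_k² ≥ c_k`). [folklore] -/
theorem norm_Sfield_le_div {α₀ : ℝ}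
    (hF0 : ∀ k μ ν x, ‖Fstr (fine (lev L k) M) (lev L k) (fun ν x => (V k ν x : Matrix n n ℂ)) μ ν x‖ ≤ α₀) (k : ℕ) (μ ν : Fin d)
    (x : Tor (fine (lev L k) M)) :
    ‖Sfield (fine (lev L k) M) (lev L k) c e (fun ν x => (V k ν x : Matrix n n ℂ)) μ ν x‖ ≤ ‖symL c e‖ * α₀ ^ 2 / 2 / (lev L k : ℕ) := by
  refine (norm_Sfield_le L M c e V hF0 k μ ν x).trans ?_
  rw [← div_div]
  exact div_levsq_le L (by positivity) k

omit hM in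
/-- **(S-size) one level up, with the coarser level factor**: `‖S_{k+1}‖ ≤ (‖symL‖·α₀²/2)/L^k` (`c_{k+1}² ≥ c_k`). [folklore] -/
theorem norm_Sfield_succ_le_div {α₀ : ℝ}
    (hF0 : ∀ k μ ν x, ‖Fstr (fine (lev L k) M) (lev L k) (fun ν x => (V k ν x : Matrix n n ℂ)) μ ν x‖ ≤ α₀) (k : ℕ) (μ ν : Fin d)
    (y : Tor (fine (lev L (k + 1)) M)) :
    ‖Sfield (fine (lev L (k + 1)) M) (lev L (k + 1)) c e (fun ν x => (V (k + 1) ν x : Matrix n n ℂ)) μ ν y‖ ≤ ‖symL c e‖ * α₀ ^ 2 / 2 / (lev L k : ℕ) := by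
  refine (norm_Sfield_le L M c e V hF0 (k + 1) μ ν y).trans ?_
  rw [← div_div]
  exact div_levsq_succ_le L (by positivity) k

omit hM in
/-- **(S-consistency)**: `‖S_{k+1}(y) − S_k(par y)‖ ≤ ‖symL‖·α₀²/L^k` from (F0) alone (both terms are second order). [folklore] -/
theorem Sfield_consistent {α₀ : ℝ}
    (hF0 : ∀ k μ ν x, ‖Fstr (fine (lev L k) M) (lev L k) (fun ν x => (V k ν x : Matrix n n ℂ)) μ ν x‖ ≤ α₀) (k : ℕ) (μ ν : Fin d)
    (y : Tor (fine (lev L (k + 1)) M)) :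
    ‖Sfield (fine (lev L (k + 1)) M) (lev L (k + 1)) c e (fun ν x => (V (k + 1) ν x : Matrix n n ℂ)) μ ν y
      - Sfield (fine (lev L k) M) (lev L k) c e (fun ν x => (V k ν x : Matrix n n ℂ)) μ ν (par (lev L k) L M y)‖ ≤ ‖symL c e‖ * α₀ ^ 2 / (lev L k : ℕ) := by
  refine (norm_sub_le _ _).trans ?_
  have h1 := norm_Sfield_succ_le_div L M c e V hF0 k μ ν y
  have h2 := norm_Sfield_le_div L M c e V hF0 k μ ν (par (lev L k) L M y)
  have : ‖symL c e‖ * α₀ ^ 2 / 2 / (lev L k : ℕ) + ‖symL c e‖ * α₀ ^ 2 / 2 / (lev L k : ℕ) = ‖symL c e‖ * α₀ ^ 2 / (lev L k : ℕ) := by ring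
  linarith

omit hM in
/-- **(S-Lipschitz)**: `‖S_k(x − e_λ) − S_k(x)‖ ≤ ‖symL‖·α₀²/L^k` from (F0) alone. [folklore] -/
theorem Sfield_lipschitz {α₀ : ℝ}
    (hF0 : ∀ k μ ν x, ‖Fstr (fine (lev L k) M) (lev L k) (fun ν x => (V k ν x : Matrix n n ℂ)) μ ν x‖ ≤ α₀) (k : ℕ) (μ ν lam : Fin d)
    (x : Tor (fine (lev L k) M)) :
    ‖Sfield (fine (lev L k) M) (lev L k) c e (fun ν x => (V k ν x : Matrix n n ℂ)) μ ν (x - unitVec _ lam)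
      - Sfield (fine (lev L k) M) (lev L k) c e (fun ν x => (V k ν x : Matrix n n ℂ)) μ ν x‖ ≤ ‖symL c e‖ * α₀ ^ 2 / (lev L k : ℕ) := by
  refine (norm_sub_le _ _).trans ?_
  have h1 := norm_Sfield_le_div L M c e V hF0 k μ ν (x - unitVec _ lam)
  have h2 := norm_Sfield_le_div L M c e V hF0 k μ ν x
  have : ‖symL c e‖ * α₀ ^ 2 / 2 / (lev L k : ℕ) + ‖symL c e‖ * α₀ ^ 2 / 2 / (lev L k : ℕ) = ‖symL c e‖ * α₀ ^ 2 / (lev L k : ℕ) := by ring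
  linarith

omit [NeZero L] hM in
/-- **(B-size)**: `‖B_k‖ ≤ ‖brkL‖·α₀` from (F0). [folklore] -/
theorem norm_Bfield_le {α₀ : ℝ}
    (hF0 : ∀ k μ ν x, ‖Fstr (fine (lev L k) M) (lev L k) (fun ν x => (V k ν x : Matrix n n ℂ)) μ ν x‖ ≤ α₀) (k : ℕ) (μ ν : Fin d)
    (x : Tor (fine (lev L k) M)) :
    ‖Bfield (fine (lev L k) M) (lev L k) c e (fun ν x => (V k ν x : Matrix n n ℂ)) μ ν x‖ ≤ ‖brkL c e‖ * α₀ := by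
  rw [Bfield]
  refine (norm_brkF_le c e _).trans (mul_le_mul_of_nonneg_left ?_ (norm_nonneg (brkL c e)))
  exact (norm_csq_smul_imHol_le (fun μ x => (V k μ x).2) μ ν x).trans (hF0 k μ ν x)

/-- **(B-consistency)**: `‖B_{k+1}(y) − B_k(par y)‖ ≤ ‖brkL‖·ρ/L^k` from the block-parent consistency (Fc) of the field strength (node NE3's currency).
[folklore] -/
theorem Bfield_consistent {ρ : ℝ}
    (hFc : ∀ k μ ν (y : Tor (fine (lev L (k + 1)) M)), ‖Fstr (fine (lev L (k + 1)) M) (lev L (k + 1)) (fun ν x => (V (k + 1) ν x : Matrix n n ℂ)) μ ν y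
      - Fstr (fine (lev L k) M) (lev L k) (fun ν x => (V k ν x : Matrix n n ℂ)) μ ν (par (lev L k) L M y)‖ ≤ ρ / (lev L k : ℕ))
    (k : ℕ) (μ ν : Fin d) (y : Tor (fine (lev L (k + 1)) M)) :
    ‖Bfield (fine (lev L (k + 1)) M) (lev L (k + 1)) c e (fun ν x => (V (k + 1) ν x : Matrix n n ℂ)) μ ν y
      - Bfield (fine (lev L k) M) (lev L k) c e (fun ν x => (V k ν x : Matrix n n ℂ)) μ ν (par (lev L k) L M y)‖ ≤ ‖brkL c e‖ * ρ / (lev L k : ℕ) := by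
  rw [Bfield, Bfield, mul_div_assoc]
  refine (norm_brkF_sub_le c e _ _).trans (mul_le_mul_of_nonneg_left ?_ (norm_nonneg (brkL c e)))
  exact (norm_csq_smul_imHol_sub_le (fun μ x => (V k μ x).2) (fun μ x => (V (k + 1) μ x).2) μ ν _ μ ν y).trans (hFc k μ ν y)

/-- **(B-Lipschitz)**: `‖B_k(x − e_λ) − B_k(x)‖ ≤ ‖brkL‖·α₀′/L^k` from the lattice-Lipschitz bound (F1) of the field strength (the (3.36) shape). [folklore] -/
theorem Bfield_lipschitz {α₀' : ℝ}
    (hF1 : ∀ k μ ν lam (x : Tor (fine (lev L k) M)), ‖Fstr (fine (lev L k) M) (lev L k) (fun ν x => (V k ν x : Matrix n n ℂ)) μ ν (x - unitVec _ lam)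
      - Fstr (fine (lev L k) M) (lev L k) (fun ν x => (V k ν x : Matrix n n ℂ)) μ ν x‖ ≤ α₀' / (lev L k : ℕ))
    (k : ℕ) (μ ν lam : Fin d) (x : Tor (fine (lev L k) M)) :
    ‖Bfield (fine (lev L k) M) (lev L k) c e (fun ν x => (V k ν x : Matrix n n ℂ)) μ ν (x - unitVec _ lam)
      - Bfield (fine (lev L k) M) (lev L k) c e (fun ν x => (V k ν x : Matrix n n ℂ)) μ ν x‖ ≤ ‖brkL c e‖ * α₀' / (lev L k : ℕ) := by
  rw [Bfield, Bfield, mul_div_assoc]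
  refine (norm_brkF_sub_le c e _ _).trans (mul_le_mul_of_nonneg_left ?_ (norm_nonneg (brkL c e)))
  exact (norm_csq_smul_imHol_sub_le (fun μ x => (V k μ x).2) (fun μ x => (V k μ x).2) μ ν x μ ν _).trans (hF1 k μ ν lam x)

end Tower

/-! ## §4 The rate END with the `Δ′` hypotheses reduced to four bounds on the data -/

section Rate

variable {d : ℕ} (L : ℕ) [NeZero L] (M : Fin d → ℕ) [hM : ∀ μ, NeZero (M μ)] (a : ℝ) (ha : 0 < a) {c : ℝ} {e : ι → Matrix n n ℂ}

include ha in
/-- **RATE END FOR PRINT'S (3.26) SHAPE, `Δ′` READ FROM THE FIELD STRENGTH OF THE DATA.**  `PrincipalB9Rate.balaban326_rate_of_small` with its six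
plaquette-field binders (`hSb hSc hSl hBb hBc hBl`) DISCHARGED by §3: the `Δ′` hypotheses are now FOUR bounds on the data tower `V` — `‖V_k − 1‖ ≤ α₁/L^k`
((3.35) size shape), `‖F_k‖ ≤ α₀` ((3.35) plaquette shape), `‖F_k(x − e_λ) − F_k(x)‖ ≤ α₀′/L^k` ((3.36) shape), `‖F_{k+1}(y) − F_k(par y)‖ ≤ ρ/L^k` (node NE3's
currency) — with `F_k = c_k²(U_k(∂p) − 1)` (`Fstr`); the connection binders (`RegularSites (Ad ∘ V)`, node NE3's `LocalRate` BY NAME), `α, β ≤ η ≤ etaStar` and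
ONE threshold are as there.  Model level: `V` is DATA; that Bałaban's minimiser satisfies the four bounds is node NE3 (OPEN) + (3.35)–(3.36); the averaging
is the model's (residual r2); NE2 (U1a) NOT proved by this. [cite: Balaban1985BackgroundPropagators, (3.10) p.392, (3.26) p.395, (3.35)–(3.36) p.396 (shapes)] [folklore] -/
theorem balaban326_rate_of_fieldStrength [Nonempty n] [Nonempty ι] {Pc : Submodule ℝ (Matrix n n ℂ)} (hF : CompFamily c Pc e) (hL : 2 ≤ L) (hd : 1 ≤ d)
    (V : (k : ℕ) → Fin d → Tor (fine (lev L k) M) → Matrix.unitaryGroup n ℂ)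
    {α β β₂ : ℝ} (hreg₂ : RegularSites L M (fun k ν x => adRep hF (V k ν x)) α β β₂) {C : ℝ} (hC : 0 ≤ C)
    (hNE3₂ : LocalRate (bgReadings L M (regClass₂ L M (fun k ν x => adRep hF (V k ν x)))) C ((L : ℝ)⁻¹)) {a' : ℝ} (ha' : 0 < a')
    {η : ℝ} (hαη : α ≤ η) (hβη : β ≤ η) (hη : η ≤ etaStar ι d a a')
    {α₁ α₀ α₀' ρ : ℝ} (hα₁ : 0 ≤ α₁) (hα₀ : 0 ≤ α₀) (hα₀' : 0 ≤ α₀') (hρ : 0 ≤ ρ)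
    (hV1 : ∀ k μ x, ‖(V k μ x : Matrix n n ℂ) - 1‖ ≤ α₁ / (lev L k : ℕ))
    (hF0 : ∀ k μ ν x, ‖Fstr (fine (lev L k) M) (lev L k) (fun ν x => (V k ν x : Matrix n n ℂ)) μ ν x‖ ≤ α₀)
    (hF1 : ∀ k μ ν lam (x : Tor (fine (lev L k) M)), ‖Fstr (fine (lev L k) M) (lev L k) (fun ν x => (V k ν x : Matrix n n ℂ)) μ ν (x - unitVec _ lam)
      - Fstr (fine (lev L k) M) (lev L k) (fun ν x => (V k ν x : Matrix n n ℂ)) μ ν x‖ ≤ α₀' / (lev L k : ℕ))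
    (hFc : ∀ k μ ν (y : Tor (fine (lev L (k + 1)) M)), ‖Fstr (fine (lev L (k + 1)) M) (lev L (k + 1)) (fun ν x => (V (k + 1) ν x : Matrix n n ℂ)) μ ν y
      - Fstr (fine (lev L k) M) (lev L k) (fun ν x => (V k ν x : Matrix n n ℂ)) μ ν (par (lev L k) L M y)‖ ≤ ρ / (lev L k : ℕ))
    (hthr : (kappaBs ι d a α β (a * (epsR ι d α * (2 + epsR ι d α) * Cst d a)) (kappa4F d a a' α β)
      + (d : ℝ) ^ 2 * ((2 * β + 2 * α ^ 2) * Cst d a)) + kappaDP d a (‖symL c e‖ * α₀ ^ 2 / 2) (‖brkL c e‖ * α₀) < 1) :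
    TowerLimitRate (fun k => Qlev L M k ⊗ₖ (1 : Matrix ι ι ℂ)) ((L : ℝ) ^ d)
      (fun k => (principalB9 (fine (lev L k) M) ((lev L k : ℕ) : ℂ) (fun ν x => adRep hF (V k ν x))
          (projP (fine (lev L k) M) (Gop L M (fun k ν x => adRep hF (V k ν x)) (QuT L M ι (siteT L M (fun k ν x => adRep hF (V k ν x)))) a' k)
            (QuT L M ι (siteT L M (fun k ν x => adRep hF (V k ν x))) k))
        + (a : ℂ) • (((((lev L k : ℕ) : ℂ) ^ d) • (QcovLev L M (liftR L M (fun k ν x => adRep hF (V k ν x))) k)ᴴ)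
            * QcovLev L M (liftR L M (fun k ν x => adRep hF (V k ν x))) k)
        + deltaPrime (fine (lev L k) M) (lev L k) c e (fun ν x => (V k ν x : Matrix n n ℂ)))⁻¹)
      (Cpert ((kappaBs ι d a α β (a * (epsR ι d α * (2 + epsR ι d α) * Cst d a)) (kappa4F d a a' α β)
          + (d : ℝ) ^ 2 * ((2 * β + 2 * α ^ 2) * Cst d a)) + kappaDP d a (‖symL c e‖ * α₀ ^ 2 / 2) (‖brkL c e‖ * α₀)) (2 * d * Cst d a) (CJ d a)
        ((C2Bs ι d L a α β (betaNE3 ι C + β₂)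
            (a * C2gram (Cst d a) 1 (epsR ι d α) (2 * d * Cst d a) (CJ d a) (Cst d a)
              (CdeltaR ι d a α (theta0 d α (betaNE3 ι (betaNE3 ι C + β₂)))))
            (C4F ι d L a a' α β (betaNE3 ι C + β₂))
          + (d : ℝ) ^ 2 * (Cst d a * ((2 * β + 2 * α ^ 2) * (2 * Cst d a) + (2 * (betaNE3 ι C + β₂) + 4 * α * (betaNE3 ι C + β)) * Cst d a)))
          + CDP d a (‖symL c e‖ * α₀ ^ 2 / 2)
              (‖symL c e‖ * α₀ ^ 2 / 2 * (4 * α₁) + (‖symL c e‖ * α₀ ^ 2 + ‖symL c e‖ * α₀ ^ 2) + ‖symL c e‖ * α₀ ^ 2 / 2 * (4 * α₁))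
              (‖brkL c e‖ * α₀) (‖brkL c e‖ * α₀ * (4 * α₁) + (‖brkL c e‖ * ρ + ‖brkL c e‖ * α₀') + ‖brkL c e‖ * α₀ * (4 * α₁)))
        0 1) ((L : ℝ)⁻¹) :=
  balaban326_rate_of_small L M a ha hF hL hd V hreg₂ hC hNE3₂ ha' hαη hβη hη hα₁ (by positivity) (by positivity) (by positivity)
    (mul_nonneg (norm_nonneg (brkL c e)) hα₀) (mul_nonneg (norm_nonneg (brkL c e)) hρ) (mul_nonneg (norm_nonneg (brkL c e)) hα₀') hV1
    (norm_Sfield_le' L M c e V hF0) (Sfield_consistent L M c e V hF0) (fun k μ ν lam x => Sfield_lipschitz L M c e V hF0 k μ ν lam x)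
    (norm_Bfield_le L M c e V hF0) (Bfield_consistent L M c e V hFc) (fun k μ ν lam x => Bfield_lipschitz L M c e V hF1 k μ ν lam x) hthr

end Rate

end Summit.QuantumFields.BalabanUV.T4Continuum.NE2.DeltaPrimeFieldStrength

end
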